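import Summits.ResolutionOfSingularities.ResolutionOfSingularities.Theorems.WildQuotientsSummitReductionStubPairOrbitBlowupCentreLocalLemmas3
import Summits.ResolutionOfSingularities.ResolutionOfSingularities.Theorems.WildQuotientsSummitReductionStubPairOrbitBlowupCentreLocalLemmas5
import Summits.ResolutionOfSingularities.ResolutionOfSingularities.Theorems.WildQuotientsSummitReductionStubPairOrbitBlowupClaimOfCentre
import Literature.AlgebraicGeometry.Resolution.BlowupsProperProofs
import Mathlib.RingTheory.MvPowerSeries.NoZeroDivisors
import HarnessLib

/-!
# `WildQuotients.SummitReduction` (stmt-ResolutionOfSingularities-16324), line `FramePerfect`: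
# stub C2 (`stub_pair_orbitBlowupCentreLocal`), clause (H4) at the chart origins — assembled from the
# stub's hypotheses (file 6)

Route `ResolutionOfSingularities/WildQuotients`, crux `SummitReduction`; helper file of stub
`stub_pair_orbitBlowupCentreLocal` (C2: de Jong 1996, 3.4 Claim (ii) over the orbit centre with
quasi-splitness upstairs, de Jong 1997, proof of Prop. 5.11 ¶1) of the line skeleton (v8). For the
blow-up `π : X₁ → X` of the reduced orbit closure `Z = cl(G · x)` of a codimension-2 singular point of
a quasi-split `G`-semi-stable pair and ANY point `x'` of `X₁` over `Z`, this file PROVES, from the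
binders of the stub alone (`orbitCentreLocal_exists_chart_and_quasiSplitDatum`):

* the completed local ring `𝒪̂_{X₁,x'}` is the completion of one of de Jong's three chart rings
  `Λ[U, T']/(UT' - t)`, `Λ[V, T']/(VT' - t)`, `Λ[U', V']/(U'V' - c)` over the Cohen coordinates
  `Λ = κ(y)⟦T₁, …, T_m⟧` of the base at `y = f (π x')`, at a prime `𝔔 ⊇ 𝔪_Λ`, compatibly with
  `𝒪_{Y,y} → 𝒪_{X₁,x'}` (stub C1's formal model at `π x'`, file 5; "completion commutes with blowing
  up", files 1–3);
* and **if `𝔔` is the origin of the special fibre of its chart (`x̄, ȳ ∈ 𝔔`), the quasi-split datum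
  of the line holds at `x'`**: `(𝒪_{X₁,x'}/𝔪_y 𝒪_{X₁,x'})^ ≅ κ(y)⟦u, v⟧/(uv)` compatibly with `κ(y)`
  (file 4) — "the singular points of the fibres of `X' → Y` in `E` are rational with rational
  tangents" (de Jong 1997, p. 618).

What then remains of clause (H4) of the stub is the complementary smoothness statement: at a point
`x'` over `Z` whose chart prime does NOT contain both `x̄` and `ȳ`, `π ≫ f` is smooth (there the
chart ring is a localization of `Λ[Z, Z⁻¹]`; de Jong 1996, p. 64: "This scheme is smooth over `k`,
except at the maximal ideal `(u, t₁')`").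
-/

set_option linter.dupNamespace false

noncomputable section

open CategoryTheory CategoryTheory.Limits AlgebraicGeometry TopologicalSpace
open Literature.AlgebraicGeometry.Resolution
open Literature.AlgebraicGeometry
open Literature.AlgebraicGeometry.Resolution.DeJong1996
open IsLocalRing Scheme.IdealSheafData NodalDeformation DeJong1996.AlgebraicNodeRing

namespace Summit.ResolutionOfSingularities.ResolutionOfSingularities.Theorems

-- one definitional unification of the stalk forms `f (π x')`/`(π ≫ f) x'` is slow (kabstract on stalks)
set_option maxHeartbeats 3200000 in
/-- **The bridge from a Cohen-coordinatized formal model at `π x'` to the chart at `x'` and the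
quasi-split datum at the origins** (files 3–5 combined, hypotheses shaped as the output of
`centreLocal_exists_nodeDeformationRing_orbitCentre_cohen`). [cite: DeJong1996, 3.4 Claim (ii), p. 64] -/
theorem exists_chart_and_quasiSplitDatum_of_cohen {X₁ X Y : Scheme.{0}} [IsLocallyNoetherian X]
    [IsLocallyNoetherian X₁] [IsLocallyNoetherian Y] (π : X₁ ⟶ X) (f : X ⟶ Y) {I : X.IdealSheafData}
    (hπ : IsBlowup π I) (x' : X₁) {m : ℕ} (c t : (MvPowerSeries (Fin m) (ResidueField (Y.presheaf.stalk (f.base (π.base x')))))) (ht0 : t ≠ 0)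
    (e : AdicCompletion (maximalIdeal (X.presheaf.stalk (π.base x'))) (X.presheaf.stalk (π.base x')) ≃+*
      NodeDeformationRing (MvPowerSeries (Fin m) (ResidueField (Y.presheaf.stalk (f.base (π.base x'))))) (c * t ^ 2))
    (eA : AdicCompletion (maximalIdeal (Y.presheaf.stalk (f.base (π.base x')))) (Y.presheaf.stalk (f.base (π.base x'))) ≃+* (MvPowerSeries (Fin m) (ResidueField (Y.presheaf.stalk (f.base (π.base x'))))))
    (hcompat : ∀ a, e (algebraMap _ _ ((f.stalkMap (π.base x')).hom a)) =
      algebraMap (MvPowerSeries (Fin m) (ResidueField (Y.presheaf.stalk (f.base (π.base x'))))) _ (eA (algebraMap _ _ a)))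
    (hcentre : ((stalkIdeal I (π.base x')).map (algebraMap (X.presheaf.stalk (π.base x'))
        (AdicCompletion (maximalIdeal (X.presheaf.stalk (π.base x'))) (X.presheaf.stalk (π.base x'))))).map
        e.toRingHom =
      (nodalCentre (MvPowerSeries (Fin m) (ResidueField (Y.presheaf.stalk (f.base (π.base x'))))) c t).map (AlgebraicNodeRing.toNodeDeformationRing (MvPowerSeries (Fin m) (ResidueField (Y.presheaf.stalk (f.base (π.base x'))))) (c * t ^ 2)).toRingHom) :
    ∃ (j : Fin 3) (𝔔 : Ideal (AlgebraicNodeRing (MvPowerSeries (Fin m) (ResidueField (Y.presheaf.stalk (f.base (π.base x'))))) (chartParam _ c t j)))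
      (_ : 𝔔.IsPrime) (E : LocalCpl (X₁.presheaf.stalk x') ≃+* LocalCpl (Localization.AtPrime 𝔔)),
      (maximalIdeal (MvPowerSeries (Fin m) (ResidueField (Y.presheaf.stalk (f.base (π.base x')))))).map (algebraMap _ _) ≤ 𝔔 ∧
      (∀ a : (Y.presheaf.stalk ((π ≫ f).base x')), E (AdicCompletion.of _ _ (((π ≫ f).stalkMap x').hom a)) =
        AdicCompletion.of _ _ (algebraMap _ (Localization.AtPrime 𝔔)
          ((eA.toRingHom.comp (algebraMap (Y.presheaf.stalk (f.base (π.base x'))) (AdicCompletion (maximalIdeal (Y.presheaf.stalk (f.base (π.base x')))) (Y.presheaf.stalk (f.base (π.base x')))))) a))) ∧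
      (u _ (chartParam _ c t j) ∈ 𝔔 → v _ (chartParam _ c t j) ∈ 𝔔 →
        ∃ eq : AdicCompletion
            ((IsLocalRing.maximalIdeal (X₁.presheaf.stalk x')).map (Ideal.Quotient.mk
              ((IsLocalRing.maximalIdeal (Y.presheaf.stalk ((π ≫ f).base x'))).map ((π ≫ f).stalkMap x').hom)))
            (X₁.presheaf.stalk x' ⧸
              (IsLocalRing.maximalIdeal (Y.presheaf.stalk ((π ≫ f).base x'))).map ((π ≫ f).stalkMap x').hom) ≃+*
          MvPowerSeries (Fin 2) (Y.presheaf.stalk ((π ≫ f).base x') ⧸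
              IsLocalRing.maximalIdeal (Y.presheaf.stalk ((π ≫ f).base x'))) ⧸
            Ideal.span {(MvPowerSeries.X 0 * MvPowerSeries.X 1 :
              MvPowerSeries (Fin 2) (Y.presheaf.stalk ((π ≫ f).base x') ⧸
                IsLocalRing.maximalIdeal (Y.presheaf.stalk ((π ≫ f).base x'))))},
          eq.toRingHom.comp ((algebraMap (X₁.presheaf.stalk x' ⧸
              (IsLocalRing.maximalIdeal (Y.presheaf.stalk ((π ≫ f).base x'))).map ((π ≫ f).stalkMap x').hom) _).comp
            (Ideal.quotientMap ((IsLocalRing.maximalIdeal (Y.presheaf.stalk ((π ≫ f).base x'))).map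
              ((π ≫ f).stalkMap x').hom) ((π ≫ f).stalkMap x').hom Ideal.le_comap_map)) =
          algebraMap (Y.presheaf.stalk ((π ≫ f).base x') ⧸
            IsLocalRing.maximalIdeal (Y.presheaf.stalk ((π ≫ f).base x'))) _) := by
  classical
  haveI : IsNoetherianRing (MvPowerSeries (Fin m) (ResidueField (Y.presheaf.stalk (f.base (π.base x'))))) := isNoetherianRing_mvPowerSeries _ (Fin m)
  have ht : t ∈ nonZeroDivisors (MvPowerSeries (Fin m) (ResidueField (Y.presheaf.stalk (f.base (π.base x'))))) := mem_nonZeroDivisors_of_ne_zero ht0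
  -- `β = eA ∘ (𝒪_{Y,y} → 𝒪̂_{Y,y})` in composed form, and the compatibility rewritten with it
  have hcompatβ : ∀ a, e (algebraMap _ _ ((f.stalkMap (π.base x')).hom a)) =
      algebraMap (MvPowerSeries (Fin m) (ResidueField (Y.presheaf.stalk (f.base (π.base x'))))) (NodeDeformationRing (MvPowerSeries (Fin m) (ResidueField (Y.presheaf.stalk (f.base (π.base x'))))) (c * t ^ 2))
        ((eA.toRingHom.comp (algebraMap (Y.presheaf.stalk (f.base (π.base x'))) (AdicCompletion (maximalIdeal (Y.presheaf.stalk (f.base (π.base x')))) (Y.presheaf.stalk (f.base (π.base x')))))) a) := by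
    intro a
    rw [RingHom.comp_apply, RingEquiv.toRingHom_eq_coe, RingHom.coe_coe]
    exact hcompat a
  -- files 3–5: the transfer, the residue facts of `β`, the datum at the origins
  exact exists_chart_and_quasiSplitDatum_of_nodeDeformationRing_compat π f hπ ht e hcentre
    (eA.toRingHom.comp (algebraMap (Y.presheaf.stalk (f.base (π.base x'))) (AdicCompletion (maximalIdeal (Y.presheaf.stalk (f.base (π.base x')))) (Y.presheaf.stalk (f.base (π.base x')))))) hcompatβ
    (map_maximalIdeal_cohen_comp_eq eA) (residuallySurjective_cohen_comp eA)

-- bridging stub C1's statement forms to the transfer's costs one slow definitional unification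
set_option maxHeartbeats 3200000 in
/-- **Stub C2, clause (H4) at the chart origins, from the stub's binders.** For the blow-up
`π : X₁ → X` of the reduced orbit closure `Z = cl(G · x)` of a codimension-2 singular point `x` of a
quasi-split `G`-semi-stable pair (binders of `stub_pair_orbitBlowupCentreLocal`, those used) and any
point `x'` of `X₁` over `Z`: Cohen coordinates `eA : 𝒪̂_{Y,y} ≅ Λ = κ(y)⟦T₁, …, T_m⟧`, `y = f (π x')`,
a chart index `j`, a prime `𝔔 ⊇ 𝔪_Λ` of the `j`-th chart ring `Λ[x, y]/(xy - a_j)`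
(`a_j = t, t, c`), an identification `𝒪̂_{X₁,x'} ≅ (chart ring)_𝔔^` compatible with
`𝒪_{Y,y} → 𝒪_{X₁,x'}` and `𝒪_{Y,y} → Λ → (chart ring)_𝔔`, and — when `x̄, ȳ ∈ 𝔔` — the quasi-split
datum `(𝒪_{X₁,x'}/𝔪_y𝒪_{X₁,x'})^ ≅ κ(y)⟦u, v⟧/(uv)` over `κ(y)`.
[cite: DeJong1996, 3.4 Claim (ii), pp. 63–64] [cite: DeJong1997, proof of Prop. 5.11, p. 618] -/
theorem orbitCentreLocal_exists_chart_and_quasiSplitDatum (k : Type) [Field k] (Y : Scheme.{0})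
    [IsIntegral Y] (q : Y ⟶ Spec (.of k)) (hreg : Scheme.IsRegular Y) (D : Set Y)
    (hD : IsStrictNormalCrossingsDivisor Y D) (G : Type) [Group G] [Finite G]
    (X : Scheme.{0}) [IsIntegral X] (f : X ⟶ Y) (ρX : G →* Aut X)
    (hprojX : Motives.IsProjectiveOver (Over.mk (f ≫ q)))
    (hss : IsSemiStableCurve f)
    (hqs : (∀ x : X, (¬ ∃ U : X.Opens, x ∈ U ∧ Smooth (U.ι ≫ f)) →
        ∃ e : AdicCompletion
            ((IsLocalRing.maximalIdeal (X.presheaf.stalk x)).map (Ideal.Quotient.mk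
              ((IsLocalRing.maximalIdeal (Y.presheaf.stalk (f.base x))).map (f.stalkMap x).hom)))
            (X.presheaf.stalk x ⧸
              (IsLocalRing.maximalIdeal (Y.presheaf.stalk (f.base x))).map (f.stalkMap x).hom) ≃+*
          MvPowerSeries (Fin 2) (Y.presheaf.stalk (f.base x) ⧸ IsLocalRing.maximalIdeal (Y.presheaf.stalk (f.base x))) ⧸
            Ideal.span {(MvPowerSeries.X 0 * MvPowerSeries.X 1 :
              MvPowerSeries (Fin 2) (Y.presheaf.stalk (f.base x) ⧸ IsLocalRing.maximalIdeal (Y.presheaf.stalk (f.base x))))},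
          e.toRingHom.comp ((algebraMap (X.presheaf.stalk x ⧸
              (IsLocalRing.maximalIdeal (Y.presheaf.stalk (f.base x))).map (f.stalkMap x).hom) _).comp
            (Ideal.quotientMap ((IsLocalRing.maximalIdeal (Y.presheaf.stalk (f.base x))).map (f.stalkMap x).hom)
              (f.stalkMap x).hom Ideal.le_comap_map)) =
          algebraMap (Y.presheaf.stalk (f.base x) ⧸ IsLocalRing.maximalIdeal (Y.presheaf.stalk (f.base x))) _))
    (hsm : Smooth (f ∣_ ⟨Dᶜ, hD.isClosed.isOpen_compl⟩))
    (x : X) (hx : x ∈ Scheme.singularLocusCodimLE X 2) (X₁ : Scheme.{0}) (π : X₁ ⟶ X)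
    (hπ : IsBlowup π (Scheme.IdealSheafData.vanishingIdeal
      ⟨closure (Set.range fun g : G => (ρX g).hom.base x), isClosed_closure⟩))
    (x' : X₁) (hx' : π.base x' ∈ closure (Set.range fun g : G => (ρX g).hom.base x)) :
    ∃ (m : ℕ) (c t : MvPowerSeries (Fin m) (ResidueField (Y.presheaf.stalk (f.base (π.base x')))))
      (eA : AdicCompletion (maximalIdeal (Y.presheaf.stalk (f.base (π.base x')))) (Y.presheaf.stalk (f.base (π.base x'))) ≃+* MvPowerSeries (Fin m) (ResidueField (Y.presheaf.stalk (f.base (π.base x')))))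
      (j : Fin 3) (𝔔 : Ideal (AlgebraicNodeRing (MvPowerSeries (Fin m) (ResidueField (Y.presheaf.stalk (f.base (π.base x'))))) (chartParam _ c t j)))
      (_ : 𝔔.IsPrime) (E : LocalCpl (X₁.presheaf.stalk x') ≃+* LocalCpl (Localization.AtPrime 𝔔)),
      t ≠ 0 ∧
      (maximalIdeal (MvPowerSeries (Fin m) (ResidueField (Y.presheaf.stalk (f.base (π.base x')))))).map (algebraMap _ _) ≤ 𝔔 ∧
      (∀ a : (Y.presheaf.stalk ((π ≫ f).base x')), E (AdicCompletion.of _ _ (((π ≫ f).stalkMap x').hom a)) =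
        AdicCompletion.of _ _ (algebraMap _ (Localization.AtPrime 𝔔)
          ((eA.toRingHom.comp (algebraMap (Y.presheaf.stalk (f.base (π.base x'))) (AdicCompletion (maximalIdeal (Y.presheaf.stalk (f.base (π.base x')))) (Y.presheaf.stalk (f.base (π.base x')))))) a))) ∧
      (u _ (chartParam _ c t j) ∈ 𝔔 → v _ (chartParam _ c t j) ∈ 𝔔 →
        ∃ eq : AdicCompletion
            ((IsLocalRing.maximalIdeal (X₁.presheaf.stalk x')).map (Ideal.Quotient.mk
              ((IsLocalRing.maximalIdeal (Y.presheaf.stalk ((π ≫ f).base x'))).map ((π ≫ f).stalkMap x').hom)))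
            (X₁.presheaf.stalk x' ⧸
              (IsLocalRing.maximalIdeal (Y.presheaf.stalk ((π ≫ f).base x'))).map ((π ≫ f).stalkMap x').hom) ≃+*
          MvPowerSeries (Fin 2) (Y.presheaf.stalk ((π ≫ f).base x') ⧸
              IsLocalRing.maximalIdeal (Y.presheaf.stalk ((π ≫ f).base x'))) ⧸
            Ideal.span {(MvPowerSeries.X 0 * MvPowerSeries.X 1 :
              MvPowerSeries (Fin 2) (Y.presheaf.stalk ((π ≫ f).base x') ⧸
                IsLocalRing.maximalIdeal (Y.presheaf.stalk ((π ≫ f).base x'))))},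
          eq.toRingHom.comp ((algebraMap (X₁.presheaf.stalk x' ⧸
              (IsLocalRing.maximalIdeal (Y.presheaf.stalk ((π ≫ f).base x'))).map ((π ≫ f).stalkMap x').hom) _).comp
            (Ideal.quotientMap ((IsLocalRing.maximalIdeal (Y.presheaf.stalk ((π ≫ f).base x'))).map
              ((π ≫ f).stalkMap x').hom) ((π ≫ f).stalkMap x').hom Ideal.le_comap_map)) =
          algebraMap (Y.presheaf.stalk ((π ≫ f).base x') ⧸
            IsLocalRing.maximalIdeal (Y.presheaf.stalk ((π ≫ f).base x'))) _) := by
  classical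
  haveI : IsNoetherian X := DeJong1996.isNoetherian_of_isProjectiveOver (f ≫ q) hprojX
  haveI : IsLocallyNoetherian Y := isLocallyNoetherian_base hss
  haveI : IsProper (f ≫ q) := Motives.IsProjectiveOver.isProper (X := Over.mk (f ≫ q)) hprojX
  haveI : LocallyOfFiniteType (f ≫ q) := inferInstance
  haveI : IsProper π := hπ.isProper
  haveI : IsLocallyNoetherian X₁ := LocallyOfFiniteType.isLocallyNoetherian π
  -- the formal model at `z = π x'` with its Cohen coordinates (stub C1 + file 5)
  obtain ⟨m, c, t, ht0, e, eA, hcompat, hcentre⟩ :=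
    centreLocal_exists_nodeDeformationRing_orbitCentre_cohen q hreg hD f hss hqs hsm ρX hx hx'
  obtain ⟨j, 𝔔, h𝔔, E, h𝔔Λ, hE, hnode⟩ :=
    exists_chart_and_quasiSplitDatum_of_cohen π f hπ x' c t ht0 e eA hcompat hcentre
  exact ⟨m, c, t, eA, j, 𝔔, h𝔔, E, ht0, h𝔔Λ, hE, hnode⟩

end Summit.ResolutionOfSingularities.ResolutionOfSingularities.Theorems

end
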